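import Literature.AlgebraicGeometry.Frobenioids.ModelFrobenioidSelfEquivalenceRigidity
import HarnessLib

/-!
# Frobenioids I, Thm. 5.2 (i): the UNIT-TWIST self-equivalences of a model Frobenioid — the law
# «every self-equivalence over the identity of the base induces `u_{Ψ φ} = η^* u_φ`» is unsatisfiable
# at any model Frobenioid carrying a non-trivial divisor-free natural unit (OURS; a vacuity witness)

Mochizuki, *The geometry of Frobenioids I: the general theory*, Kyushu J. Math. **62** (2008)
293–400, §5 Theorem 5.2 (i) p. 100: a morphism of the model Frobenioid `C` of `(Φ, B, Div_B)` on `D`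
IS the quadruple `(deg_Fr, Base, Div, u)` subject to relation (d) (`ModelFrobenioid.lean`)
[cite: MochizukiFrdI2008, Thm. 5.2(i) p.100]; Theorem 5.2 (ii) p. 101: "there is a natural isomorphism
of functors between the functor `O^×(−)` on `D` associated to the Frobenioid `C^birat` […] and the
functor `B`" — so `B` is the RATIONAL FUNCTION MONOID, a functor of *birational* units
[cite: MochizukiFrdI2008, Thm. 5.2(ii) p.101].  Consumer locus: Mochizuki, *Inter-universal Teichmüller
theory I*, proof of Corollary 5.3 (iv), kurims manuscript (May 2020) p. 145 l. 1–2: "it suffices to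
verify that `α` induces […] the identity on the rational function and divisor monoids of `ℱ̲_v`"
[cite: Mochizuki2012, Cor. 5.3(iv) p.145] (D-0012 claim key; nothing of that series is asserted here; no
side taken on [IUTchIII] Cor. 3.12).

WHAT THIS FILE PROVES (PROOF-ONLY; a theorem about OUR model category, NOT a construction of either
paper; abc-iut cell, L5 row «HMON-LAW-VACUITY-WITNESS» = L5-R22, report of an unsatisfiable displayed
binder per the cell's token standard).  The knit `Literature.IUT.HodgeTheaters.Cor53.descend_injective_model_of_monoidRigid`
(and its siblings `descend_injective_of_monoidRigid`, `…_bijective_…`) display the LAW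

  `hmon : ∀ Ψ : C ≌ C, Nonempty (Ψ.functor ⋙ Base ≅ Base) → ∃ η : Ψ.functor ⋙ Base ≅ Base,`
  `  (∀ φ, Div(Ψ φ) = η_X^* Div(φ)) ∧ (∀ φ, u_{Ψ φ} = η_X^* u_φ)`,

whose second clause reads print's «identity on the rational function monoid» ENTRY-WISE on the
quadruple entry `u_φ ∈ B(A)` of EVERY morphism (the `u = 1` "gauge-fixed" form of abc-iut-L1-t7's
rigidity theorem `ModelFrobenioid.selfEquivalence_iso_id_of_over_base`, which is a correct theorem).
As a LAW over all `Ψ` this is FALSE as soon as `B` carries a family of units `w_A ∈ B(A)` that is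
divisor-free (`Div_B(w_A) = 0`), base-compatible (`B(f)(w_{A'}) = w_A`) and non-trivial (`w_A ≠ 1` for
some `A`) — e.g. `w = −1 ∈ K^×` at any carrier whose `B(A)` is the multiplicative group of a field of
characteristic `≠ 2` (the `p`-adic Frobenioids of [FrdII] Ex. 1.1, the tempered Frobenioids of
[EtTh] §3–5).  WITNESS (built inside the proofs, no `def`): the UNIT TWIST `Ψ_w : C ⥤ C`, identity on
objects and on `(deg_Fr, Base, Div)`, `u_{Ψ_w φ} := u_φ · w_A^{deg_Fr(φ) − 1}` (`A = Base` of the source)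
— the conjugate `φ ↦ θ_X ∘ φ ∘ θ_Y⁻¹` of the identity functor by the divisor-free automorphisms
`θ_X := (1, id, 0, w) ∈ Aut(X)`; it is a functor ISOMORPHIC TO `𝟭_C` through `θ` (hence a
self-equivalence lying over `𝟭_D` ON THE NOSE, preserving `deg_Fr` and `Div` — no threat to the
injectivity CONCLUSION of [IUTchI] Cor. 5.3 (iv)), yet along the degree-`2` Frobenius endomorphism
`Fr₂ := (2, id, 0, 1)` of `(A, 0)` one has `u_{Ψ_w Fr₂} = w_A`, whereas the displayed clause demands
`u_{Ψ Fr₂} = η_A^*(u_{Fr₂}) = η_A^*(1) = 1` for EVERY `η`.  (The entry `u_φ` of a single morphism is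
not category-theoretic; only ratios `u_f / u_g` of parallel linear morphisms over the same base map
are — they are birational units, [FrdI] Cor. 4.10, Thm. 5.2 (ii); print's hypothesis is about those.)

Main results: `exists_unitTwist_selfEquivalence` (the witness with all its properties),
`not_forall_selfEquivalence_over_id_hdiv_hunit` (¬ the `hmon` binder of
`Cor53.descend_injective_model_of_monoidRigid`, copied verbatim),
`not_forall_selfEquivalence_over_id_hdeg_hdiv_hunit` (¬ the `hmon` binder of
`Cor53.descend_injective_of_monoidRigid`, verbatim), `not_forall_selfEquivalence_over_id_hunit` (¬ the
unit clause alone).  Honest framing: nothing here asserts abc proved or refuted; typed ≠ proved; this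
is OUR bookkeeping about which typed reading of p. 145 l. 1–2 is satisfiable.
-/

namespace Literature.AlgebraicGeometry.Frobenioids

open CategoryTheory Opposite

universe w v u

namespace ModelFrobenioid

/-- Exponent bookkeeping for the unit twist along a composite: `e·d − 1 = (e − 1) + e·(d − 1)` for
positive naturals. [folklore] -/
private theorem natPred_mul_eq (e d : ℕ+) : (e * d).natPred = e.natPred + (e : ℕ) * d.natPred := by
  simp only [PNat.natPred, PNat.mul_coe]
  rw [Nat.mul_sub_one]
  have h1 : 1 ≤ (e : ℕ) := e.pos
  have h2 : (e : ℕ) ≤ (e : ℕ) * (d : ℕ) := Nat.le_mul_of_pos_right _ d.pos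
  omega

/-- Monoid bookkeeping for the unit twist along a composite:
`a · u^e · x^{(e−1) + e·n} = (a · x^{e−1}) · (u · x^n)^e` in a commutative monoid. [folklore] -/
private theorem twist_comp_aux {M : Type*} [CommMonoid M] (a u x : M) (e : ℕ+) (n : ℕ) :
    a * u ^ (e : ℕ) * x ^ (e.natPred + (e : ℕ) * n) = a * x ^ e.natPred * (u * x ^ n) ^ (e : ℕ) := by
  rw [pow_add, mul_comm (e : ℕ) n, pow_mul, mul_pow]
  exact mul_mul_mul_comm _ _ _ _

variable {D : Type u} [Category.{v} D] {Φ B : Dᵒᵖ ⥤ CommMonCat.{w}} {DivB : B ⟶ monoidGp Φ}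
  (w : ∀ A : D, B.obj (op A))
  (hwu : ∀ A : D, IsUnit (w A))
  (hw0 : ∀ A : D, divB Φ B DivB (op A) (w A) = 1)
  (hwn : ∀ ⦃A A' : D⦄ (f : A ⟶ A'), pull B f (w A') = w A)
  (hw1 : ∃ A : D, w A ≠ 1)

include hwu hw0 hwn hw1

/-- **The unit-twist self-equivalence (OURS; vacuity witness for the entry-wise unit law).**  Let `C` be
the model Frobenioid of `(Φ, B, Div_B)` on `D` ([FrdI] Thm. 5.2 (i)) and `w_A ∈ B(A)` (`A ∈ Ob(D)`) a
family of units that is divisor-free (`Div_B(w_A) = 0`), base-compatible (`B(f)(w_{A'}) = w_A`) and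
non-trivial.  Then there is a self-equivalence `Ψ : C ≌ C` — the unit twist `u_φ ↦ u_φ · w^{deg_Fr φ − 1}`,
identity on objects and on `(deg_Fr, Base, Div)` — together with an identification
`η : Ψ ⋙ Base ≅ Base` (componentwise the identity) such that `Ψ` preserves Frobenius degrees, induces
the identity on the divisor monoid `Φ` through `η`, is isomorphic to `𝟭_C` (through the divisor-free
automorphisms `(1, id, 0, w_X)`), and yet for NO identification `η'` of its base part with the identity
does `u_{Ψ φ} = η'^* u_φ` hold for all `φ` (it fails at the degree-`2` Frobenius endomorphism
`(2, id, 0, 1)` of `(A, 0)` with `w_A ≠ 1`).  Not a construction of either paper.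
[cite: MochizukiFrdI2008, Thm. 5.2(i) p.100] -/
theorem exists_unitTwist_selfEquivalence :
    ∃ Ψ : ModelFrobenioid Φ B DivB ≌ ModelFrobenioid Φ B DivB,
      ∃ η : Ψ.functor ⋙ baseFunctor Φ B DivB ≅ baseFunctor Φ B DivB,
        (∀ ⦃X Y : ModelFrobenioid Φ B DivB⦄ (φ : X ⟶ Y), degFr (Ψ.functor.map φ) = degFr φ) ∧
        (∀ ⦃X Y : ModelFrobenioid Φ B DivB⦄ (φ : X ⟶ Y),
            div (Ψ.functor.map φ) = pull Φ (η.hom.app X : (Ψ.functor.obj X).base ⟶ X.base) (div φ)) ∧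
        Nonempty (Ψ.functor ≅ 𝟭 (ModelFrobenioid Φ B DivB)) ∧
        ∀ η' : Ψ.functor ⋙ baseFunctor Φ B DivB ≅ baseFunctor Φ B DivB,
          ¬ ∀ ⦃X Y : ModelFrobenioid Φ B DivB⦄ (φ : X ⟶ Y),
              unit (Ψ.functor.map φ) =
                pull B (η'.hom.app X : (Ψ.functor.obj X).base ⟶ X.base) (unit φ) := by
  -- base-compatibility in the `B.map` spelling used by the composition law of Thm. 5.2 (i)
  have hwn' : ∀ ⦃A A' : D⦄ (f : A ⟶ A'), (B.map f.op).hom (w A') = w A := hwn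
  -- the unit twist `Ψ_w`: identity on objects and on `(deg_Fr, Base, Div)`, `u ↦ u · w^{deg_Fr − 1}`
  let Ψ : ModelFrobenioid Φ B DivB ⥤ ModelFrobenioid Φ B DivB :=
    { obj := fun X => X
      map := fun {X Y} φ =>
        { degFr := degFr φ
          base := baseMap φ
          div := div φ
          unit := unit φ * w X.base ^ (degFr φ).natPred
          rel := by
            rw [map_mul, map_pow, hw0, one_pow, mul_one]
            exact rel φ }
      map_id := fun X => by
        refine hom_ext rfl rfl rfl ?_
        show (1 : B.obj (op X.base)) * w X.base ^ 0 = 1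
        rw [pow_zero, mul_one]
      map_comp := fun {X Y Z} φ ψ => by
        refine hom_ext rfl rfl rfl ?_
        show (B.map (baseMap φ).op).hom (unit ψ) * unit φ ^ (degFr ψ : ℕ) *
            w X.base ^ (degFr ψ * degFr φ).natPred =
          (B.map (baseMap φ).op).hom (unit ψ * w Y.base ^ (degFr ψ).natPred) *
            (unit φ * w X.base ^ (degFr φ).natPred) ^ (degFr ψ : ℕ)
        rw [map_mul, map_pow, hwn', natPred_mul_eq]
        exact twist_comp_aux _ _ _ _ _ }
  -- the inverse units `w_A⁻¹`, divisor-free as well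
  have hv : ∀ A : D, w A * ((hwu A).unit⁻¹ : (B.obj (op A))ˣ) = 1 := fun A => (hwu A).mul_val_inv
  have hv' : ∀ A : D, (((hwu A).unit⁻¹ : (B.obj (op A))ˣ) : B.obj (op A)) * w A = 1 :=
    fun A => (hwu A).val_inv_mul
  have hv0 : ∀ A : D, divB Φ B DivB (op A) ((hwu A).unit⁻¹ : (B.obj (op A))ˣ) = 1 := fun A => by
    have h := map_mul (divB Φ B DivB (op A)) (((hwu A).unit⁻¹ : (B.obj (op A))ˣ) : B.obj (op A)) (w A)
    rw [hv' A, map_one, hw0, mul_one] at h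
    exact h.symm
  -- the divisor-free automorphisms `θ_X := (1, id, 0, w_X)` and their inverses `(1, id, 0, w_X⁻¹)`
  let θ : ∀ X : ModelFrobenioid Φ B DivB, X ⟶ X := fun X =>
    { degFr := 1
      base := 𝟙 X.base
      div := 1
      unit := w X.base
      rel := by rw [PNat.one_coe, pow_one, map_one, mul_one, hw0, mul_one, pullGp_id] }
  let θ' : ∀ X : ModelFrobenioid Φ B DivB, X ⟶ X := fun X =>
    { degFr := 1
      base := 𝟙 X.base
      div := 1
      unit := ((hwu X.base).unit⁻¹ : (B.obj (op X.base))ˣ)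
      rel := by rw [PNat.one_coe, pow_one, map_one, mul_one, hv0, mul_one, pullGp_id] }
  have hθθ' : ∀ X, θ X ≫ θ' X = 𝟙 X := fun X => by
    refine hom_ext (mul_one 1) (Category.id_comp _) ?_ ?_
    · show pull Φ (𝟙 X.base) 1 * 1 ^ ((1 : ℕ+) : ℕ) = 1
      rw [map_one, one_pow, mul_one]
    · show pull B (𝟙 X.base) ((hwu X.base).unit⁻¹ : (B.obj (op X.base))ˣ) *
          w X.base ^ ((1 : ℕ+) : ℕ) = 1
      rw [pull_id, PNat.one_coe, pow_one]
      exact hv' X.base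
  have hθ'θ : ∀ X, θ' X ≫ θ X = 𝟙 X := fun X => by
    refine hom_ext (mul_one 1) (Category.id_comp _) ?_ ?_
    · show pull Φ (𝟙 X.base) 1 * 1 ^ ((1 : ℕ+) : ℕ) = 1
      rw [map_one, one_pow, mul_one]
    · show pull B (𝟙 X.base) (w X.base) *
          (((hwu X.base).unit⁻¹ : (B.obj (op X.base))ˣ) : B.obj (op X.base)) ^ ((1 : ℕ+) : ℕ) = 1
      rw [pull_id, PNat.one_coe, pow_one]
      exact hv X.base
  -- naturality of `θ : Ψ_w ⟶ 𝟭`: `Ψ_w φ ≫ θ_Y = θ_X ≫ φ` — the unit entries are `w_X · u_φ · w_X^{d−1}`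
  -- and `u_φ · w_X^d`
  have hnat : ∀ {X Y : ModelFrobenioid Φ B DivB} (φ : X ⟶ Y), Ψ.map φ ≫ θ Y = θ X ≫ φ := by
    intro X Y φ
    refine hom_ext ?_ ?_ ?_ ?_
    · show (1 : ℕ+) * degFr φ = degFr φ * 1
      rw [one_mul, mul_one]
    · show baseMap φ ≫ 𝟙 Y.base = 𝟙 X.base ≫ baseMap φ
      rw [Category.comp_id, Category.id_comp]
    · show pull Φ (baseMap φ) 1 * div φ ^ ((1 : ℕ+) : ℕ) = pull Φ (𝟙 X.base) (div φ) * 1 ^ (degFr φ : ℕ)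
      rw [map_one, one_mul, PNat.one_coe, pow_one, pull_id, one_pow, mul_one]
    · show pull B (baseMap φ) (w Y.base) * (unit φ * w X.base ^ (degFr φ).natPred) ^ ((1 : ℕ+) : ℕ) =
          pull B (𝟙 X.base) (unit φ) * w X.base ^ (degFr φ : ℕ)
      rw [hwn, PNat.one_coe, pow_one, pull_id, mul_left_comm, ← pow_succ', PNat.natPred_add_one]
  let ι : Ψ ≅ 𝟭 (ModelFrobenioid Φ B DivB) :=
    NatIso.ofComponents (fun X => ⟨θ X, θ' X, hθθ' X, hθ'θ X⟩) (fun φ => hnat φ)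
  -- `Ψ_w` as a self-equivalence (functor part `Ψ_w` on the nose), lying over `𝟭_D` on the nose
  let E : ModelFrobenioid Φ B DivB ≌ ModelFrobenioid Φ B DivB :=
    (CategoryTheory.Equivalence.refl (C := ModelFrobenioid Φ B DivB)).changeFunctor ι.symm
  let η : E.functor ⋙ baseFunctor Φ B DivB ≅ baseFunctor Φ B DivB :=
    NatIso.ofComponents (fun X => Iso.refl X.base) (fun {X Y} φ => by
      show baseMap φ ≫ 𝟙 Y.base = 𝟙 X.base ≫ baseMap φ
      rw [Category.comp_id, Category.id_comp])
  refine ⟨E, η, fun X Y φ => rfl, fun X Y φ => ?_, ⟨ι⟩, fun η' hunit => ?_⟩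
  · show div φ = pull Φ (𝟙 X.base) (div φ)
    rw [pull_id]
  · -- the degree-`2` Frobenius endomorphism `(2, id, 0, 1)` of `(A, 0)`, `w_A ≠ 1`
    obtain ⟨A, hA⟩ := hw1
    let X₀ : ModelFrobenioid Φ B DivB := ⟨A, 1⟩
    let Fr : X₀ ⟶ X₀ :=
      { degFr := 2
        base := 𝟙 A
        div := 1
        unit := 1
        rel := by
          show (1 : Algebra.GrothendieckGroup (Φ.obj (op A))) ^ ((2 : ℕ+) : ℕ) *
              Algebra.GrothendieckGroup.of 1 = pullGp Φ (𝟙 A) 1 * divB Φ B DivB (op A) 1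
          rw [one_pow, map_one, map_one, map_one, mul_one] }
    have h : (1 : B.obj (op A)) * w A ^ 1 = pull B (η'.hom.app X₀ : A ⟶ A) 1 := hunit Fr
    refine hA ?_
    calc w A = (1 : B.obj (op A)) * w A ^ 1 := by rw [one_mul, pow_one]
      _ = pull B (η'.hom.app X₀ : A ⟶ A) 1 := h
      _ = 1 := map_one _

/-- **¬ `hmon` (the displayed LAW of `Literature.IUT.HodgeTheaters.Cor53.descend_injective_model_of_monoidRigid`,
copied verbatim) at any model Frobenioid carrying a non-trivial divisor-free base-compatible unit.**
The law «every self-equivalence `Ψ` of `C` lying over the identity of `D` admits an identification `η`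
through which `Div(Ψ φ) = η^* Div(φ)` and `u_{Ψ φ} = η^* u_φ` for all `φ`» is unsatisfiable there: the
unit twist `Ψ_w` (`exists_unitTwist_selfEquivalence`) lies over `𝟭_D` and violates the unit clause for
every `η`.  Consequently that knit theorem is VACUOUS at such carriers (its conclusion is not claimed
false: `Ψ_w ≅ 𝟭_C`).  Print's sentence ([IUTchI] p. 145 l. 1–2 «induces the identity on the rational
function monoid», [FrdI] Thm. 5.2 (ii): `B ≅ O^×((−)^birat)`) concerns birational units, which are
insensitive to the unit twist; OUR entry-wise typing of it is what fails.  Not a statement of either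
paper. [cite: MochizukiFrdI2008, Thm. 5.2(i) p.100] [cite: Mochizuki2012, Cor. 5.3(iv) p.145] -/
theorem not_forall_selfEquivalence_over_id_hdiv_hunit :
    ¬ (∀ Ψ : ModelFrobenioid Φ B DivB ≌ ModelFrobenioid Φ B DivB,
      Nonempty (Ψ.functor ⋙ ModelFrobenioid.baseFunctor Φ B DivB ≅ ModelFrobenioid.baseFunctor Φ B DivB) →
      ∃ η : Ψ.functor ⋙ ModelFrobenioid.baseFunctor Φ B DivB ≅ ModelFrobenioid.baseFunctor Φ B DivB,
        (∀ ⦃X Y : ModelFrobenioid Φ B DivB⦄ (φ : X ⟶ Y),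
            ModelFrobenioid.div (Ψ.functor.map φ) =
              pull Φ (η.hom.app X : (Ψ.functor.obj X).base ⟶ X.base) (ModelFrobenioid.div φ)) ∧
        (∀ ⦃X Y : ModelFrobenioid Φ B DivB⦄ (φ : X ⟶ Y),
            ModelFrobenioid.unit (Ψ.functor.map φ) =
              pull B (η.hom.app X : (Ψ.functor.obj X).base ⟶ X.base) (ModelFrobenioid.unit φ))) := by
  intro hmon
  obtain ⟨Ψ, η, -, -, -, hnot⟩ := exists_unitTwist_selfEquivalence w hwu hw0 hwn hw1
  obtain ⟨η', -, hunit⟩ := hmon Ψ ⟨η⟩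
  exact hnot η' hunit

/-- **¬ `hmon` (the displayed LAW of `Literature.IUT.HodgeTheaters.Cor53.descend_injective_of_monoidRigid` /
`descendHom_injective_of_monoidRigid` / `descendBijective_of_monoidRigid_of_lifts` /
`mapIso_kindFunctor_bijective_of_monoidRigid_of_lifts`, copied verbatim — the three-clause form with
`deg_Fr`)** at any model Frobenioid carrying a non-trivial divisor-free base-compatible unit: same witness.
Not a statement of either paper. [cite: MochizukiFrdI2008, Thm. 5.2(i) p.100]
[cite: Mochizuki2012, Cor. 5.3(iv) p.145] -/
theorem not_forall_selfEquivalence_over_id_hdeg_hdiv_hunit :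
    ¬ (∀ Ψ : ModelFrobenioid Φ B DivB ≌ ModelFrobenioid Φ B DivB,
      Nonempty (Ψ.functor ⋙ ModelFrobenioid.baseFunctor Φ B DivB ≅ ModelFrobenioid.baseFunctor Φ B DivB) →
      ∃ η : Ψ.functor ⋙ ModelFrobenioid.baseFunctor Φ B DivB ≅ ModelFrobenioid.baseFunctor Φ B DivB,
        (∀ ⦃X Y : ModelFrobenioid Φ B DivB⦄ (φ : X ⟶ Y),
            ModelFrobenioid.degFr (Ψ.functor.map φ) = ModelFrobenioid.degFr φ) ∧
        (∀ ⦃X Y : ModelFrobenioid Φ B DivB⦄ (φ : X ⟶ Y),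
            ModelFrobenioid.div (Ψ.functor.map φ) =
              pull Φ (η.hom.app X : (Ψ.functor.obj X).base ⟶ X.base) (ModelFrobenioid.div φ)) ∧
        (∀ ⦃X Y : ModelFrobenioid Φ B DivB⦄ (φ : X ⟶ Y),
            ModelFrobenioid.unit (Ψ.functor.map φ) =
              pull B (η.hom.app X : (Ψ.functor.obj X).base ⟶ X.base) (ModelFrobenioid.unit φ))) := by
  intro hmon
  obtain ⟨Ψ, η, -, -, -, hnot⟩ := exists_unitTwist_selfEquivalence w hwu hw0 hwn hw1
  obtain ⟨η', -, -, hunit⟩ := hmon Ψ ⟨η⟩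
  exact hnot η' hunit

/-- **¬ (the entry-wise unit clause alone, as a law)**: at any model Frobenioid carrying a non-trivial
divisor-free base-compatible unit it is NOT the case that every self-equivalence over the identity of
the base satisfies `u_{Ψ φ} = η^* u_φ` (all `φ`) for some identification `η` — the `Div` and `deg_Fr`
clauses play no role in the failure.  Not a statement of either paper.
[cite: MochizukiFrdI2008, Thm. 5.2(i) p.100] -/
theorem not_forall_selfEquivalence_over_id_hunit :
    ¬ (∀ Ψ : ModelFrobenioid Φ B DivB ≌ ModelFrobenioid Φ B DivB,
      Nonempty (Ψ.functor ⋙ ModelFrobenioid.baseFunctor Φ B DivB ≅ ModelFrobenioid.baseFunctor Φ B DivB) →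
      ∃ η : Ψ.functor ⋙ ModelFrobenioid.baseFunctor Φ B DivB ≅ ModelFrobenioid.baseFunctor Φ B DivB,
        ∀ ⦃X Y : ModelFrobenioid Φ B DivB⦄ (φ : X ⟶ Y),
            ModelFrobenioid.unit (Ψ.functor.map φ) =
              pull B (η.hom.app X : (Ψ.functor.obj X).base ⟶ X.base) (ModelFrobenioid.unit φ)) := by
  intro hmon
  obtain ⟨Ψ, η, -, -, -, hnot⟩ := exists_unitTwist_selfEquivalence w hwu hw0 hwn hw1
  obtain ⟨η', hunit⟩ := hmon Ψ ⟨η⟩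
  exact hnot η' hunit

end ModelFrobenioid

end Literature.AlgebraicGeometry.Frobenioids
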